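import Literature.Topology.FourManifolds.LinkGaussDiagramsRealisation
import Literature.Topology.FourManifolds.LinkKhDichotomy
import Literature.Topology.FourManifolds.LinkKhDSquared
import Literature.Topology.FourManifolds.RegularProjectionParity
import Literature.Topology.PlaneTopology.SmoothUmlaufsatz
import HarnessLib

/-!
# Checkerboard colourings of regular projections of links, I: the left winding number

Topic: Topology / FourManifolds. Companion of `LinkGaussDiagramsRealisation.lean` (regular
projections `Link.RegularProjection L` of a link `L : Link ι`, the link Gauss diagram
`P.diagram` they read, with `comp`, `θ`, `eq_or_crossing`, `det_ne_zero`, …) and of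
`RegularProjectionParity.lean` (Gauss's parity condition for ONE knot, whose winding-number
engine `GaussParity.*` — `abs_mul_im_le_of_eq`, `exists_pos_forall_le_norm_sub`,
`wind_sub_eq_of_path`, `wind_sub_wind_eq_one` — is reused verbatim). The target, proved in the
sequel `LinkRegularProjectionParityProofs.lean`
(`Link.RegularProjection.exists_isCheckerboard`), is: **every link Gauss diagram read off a
regular projection of a link admits a checkerboard colouring** (`LinkGaussDiagram.IsCheckerboard`,
`LinkLeeStates.lean`), whence the merge-or-split dichotomy (`LinkKhDichotomy.lean`) and `d² = 0`
(`LinkKhDSquared.lean`) for realisable link diagrams (Kauffman (1999), §3.2: planar Gauss codes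
are evenly intersticed; Rasmussen (2010), Lemma 2.4).

## Strategy of the two files

Colour the complement of the projected link by the parity of the **total winding number**
`windSum x = Σₐ wind (γₐ - x)` of the plane strands `γₐ = (L.component a).planeCurve` (read in
`ℂ`, one period each), and colour the marked point `p` by that parity in the region to the LEFT
of the arc leaving `p`. This file constructs the region-parity function seen from the strands:

* §1 Engine supplements (namespace `GaussParity`): rotation invariance of `wind`
  (`wind_comp_add_of_periodic`, SmoothUmlaufsatz);
  a UNIFORM cone `‖f s - f s' - (s - s') f' t₀‖ ≤ κ |s - s'|` on a window
  around a point where the velocity is continuous (`exists_window_cone`, mean value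
  inequality); the three linear-algebra cores of all avoidance arguments (`ne_add_of_window_cone`:
  a strand misses the points beside it; `ne_add_of_cones`: it misses the points hugging the
  other strand of a crossing; `ne_quadrant_of_cone`: it misses the points deep in a quadrant).
* §2 `Knot.contDiff_planeCurve_of_notMem`: the plane curve of a knot missing the north pole is
  `C^∞` (the knot is smooth into `𝕊³ ⊆ ℝ⁴`, `circlePoint` is smooth, the stereographic formula
  is smooth off `x₃ = 1`); only the continuity of the velocity is used below.
* §3 Strands `Link.strand a`, the `trace`, the loops `uloop a` on `[0, 1]`, `windSum`;
  constancy of `windSum` along paths off the trace, re-basing of a strand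
  (`wind_strand_rebase`), and the compactness lemma `exists_far`: strands come close to a point
  only near the listed passages through it.
* §4 Simple points (`Link.IsSimplePt`), local frames (`Link.IsSimpleFrame`,
  `exists_isSimpleFrame`) and the **left winding number**
  `Link.leftWind a t = lim_{ε → 0⁺} windSum (γₐ t + ε i γₐ' t)`: an eventual value at simple
  points (`leftWind_spec`), computed by any direction strictly to the left
  (`windSum_add_eq_leftWind`), exceeding the value on the right by exactly one
  (`windSum_left_sub_right`: the own strand jumps by one, `wind_sub_wind_eq_one`, the others
  are far; `windSum_add_eq_leftWind_sub_one`), and constant along arcs of simple points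
  (`leftWind_eq_of_isSimplePt`: local constancy through the uniform cone and a short path beside
  the strand, then connectedness of the interval).

The sequel adds the local frames at crossings (adjacent quadrants), the combinatorics of the
traversal (the arc following a marked point consists of simple points) and the colouring.

## References

* L. H. Kauffman, *Virtual knot theory*, European J. Combin. 20 (1999) 663–690, §3.2, Lemma 1
  (planar Gauss codes are evenly intersticed). [cite: Kauffman1999, §3.2 Lemma 1]
* J. Rasmussen, *Khovanov homology and the slice genus*, Invent. Math. 182 (2010), Lemma 2.4,
  Cor. 2.5 (adjacent Seifert circles carry different labels). [cite: Rasmussen2010, §2.3]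
* L. V. Ahlfors, *Complex Analysis*, 3rd ed. (1979), §4.2.1 (winding numbers: local constancy
  and the jump across an arc).
* M. Goussarov, M. Polyak, O. Viro, Topology 39 (2000), §1 (Gauss diagrams of links).
  [cite: GPV2000, §1]

## Design notes

* No `sorry`, no axiom; the `Prop`-valued definitions (`Link.IsSimplePt`, `Link.IsSimpleFrame`)
  are genuine predicates, documented where declared. `[Fintype ι]` is assumed in the lemmas
  (it holds for links with a regular projection, `Link.RegularProjection.finite_index`) and is
  discharged in the main theorem of the sequel.
* As in the model file, winding numbers are only ever compared along explicit segments and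
  short paths shown to miss the trace by cone estimates; the one new analytic input is the
  continuity of the velocity (uniform cones), needed to move along an arc and to hug a strand
  near a crossing.
-/

noncomputable section

open Complex Set Filter Topology Function
open scoped Real Manifold ContDiff

namespace Literature.Topology.FourManifolds

open Literature.Topology.PlaneTopology GaussParity

namespace GaussParity

/-! ## 1. Engine supplements -/

/-! ### Rotating a periodic loop -/

/-! ### A uniform cone at a point where the velocity is continuous -/

/-- **Uniform cone.** If `f` has derivative `f'` everywhere and `f'` is continuous at `t₀`, then
for every `κ > 0`, on a window around `t₀` any two points of the curve satisfy
`‖f s - f s' - (s - s') f' t₀‖ ≤ κ |s - s'|`, and the velocity stays within `κ` of `f' t₀` (mean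
value inequality). [folklore] -/
theorem exists_window_cone {f f' : ℝ → ℂ} (hf : ∀ t, HasDerivAt f (f' t) t) {t₀ : ℝ}
    (hc : ContinuousAt f' t₀) {κ : ℝ} (hκ : 0 < κ) :
    ∃ δ > 0, (∀ s s', |s - t₀| ≤ δ → |s' - t₀| ≤ δ →
      ‖f s - f s' - ((s - s' : ℝ) : ℂ) * f' t₀‖ ≤ κ * |s - s'|) ∧
      ∀ s, |s - t₀| ≤ δ → ‖f' s - f' t₀‖ ≤ κ := by
  obtain ⟨δ₁, hδ₁, hball⟩ := Metric.continuousAt_iff.1 hc κ hκ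
  refine ⟨δ₁ / 2, half_pos hδ₁, fun s s' hs hs' => ?_, fun s hs => ?_⟩
  · have hvel : ∀ x ∈ Icc (t₀ - δ₁ / 2) (t₀ + δ₁ / 2), ‖f' x - f' t₀‖ ≤ κ := fun x hx => by
      rw [← dist_eq_norm]
      exact (hball (show dist x t₀ < δ₁ by
        rw [Real.dist_eq, abs_lt]; constructor <;> linarith [hx.1, hx.2])).le
    set g : ℝ → ℂ := fun u => f u - (u : ℂ) * f' t₀ with hg
    have hgd : ∀ x ∈ Icc (t₀ - δ₁ / 2) (t₀ + δ₁ / 2),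
        HasDerivWithinAt g (f' x - f' t₀) (Icc (t₀ - δ₁ / 2) (t₀ + δ₁ / 2)) x := fun x _ => by
      have h1 : HasDerivAt (fun u : ℝ => (u : ℂ) * f' t₀) (f' t₀) x := by
        simpa using (Complex.ofRealCLM.hasDerivAt (x := x)).mul_const (f' t₀)
      exact ((hf x).sub h1).hasDerivWithinAt
    have hmem : ∀ {x}, |x - t₀| ≤ δ₁ / 2 → x ∈ Icc (t₀ - δ₁ / 2) (t₀ + δ₁ / 2) := fun hx =>
      ⟨by linarith [(abs_le.1 hx).1], by linarith [(abs_le.1 hx).2]⟩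
    have := (convex_Icc _ _).norm_image_sub_le_of_norm_hasDerivWithin_le hgd hvel (hmem hs')
      (hmem hs)
    rw [Real.norm_eq_abs] at this
    have key : g s - g s' = f s - f s' - ((s - s' : ℝ) : ℂ) * f' t₀ := by
      simp only [hg]; push_cast; ring
    rwa [key] at this
  · rw [← dist_eq_norm]
    exact (hball (show dist s t₀ < δ₁ by
      rw [Real.dist_eq]; exact hs.trans_lt (half_lt_self hδ₁))).le

/-! ### Linear-algebra cores of the avoidance arguments -/

/-- `|Im (V w̄)|` is symmetric in `V`, `w`. [folklore] -/
theorem abs_im_mul_conj_comm (V w : ℂ) :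
    |(V * starRingEnd ℂ w).im| = |(w * starRingEnd ℂ V).im| := by
  rw [← Complex.conj_conj (V * starRingEnd ℂ w), map_mul, Complex.conj_conj, Complex.conj_im,
    abs_neg, mul_comm]

/-- **A strand misses the points beside it.** If `α` satisfies the uniform cone estimate with
direction `V` on the window `|s| ≤ δ`, then no point `α s' + v` with `v` pointing definitely
across `V` (`κ ‖v‖ < |Im (v V̄)|`) lies on `α` within the window. [folklore] -/
theorem ne_add_of_window_cone {α : ℝ → ℂ} {V v : ℂ} {κ δ s s' : ℝ} (hκ0 : 0 ≤ κ)
    (hα : ∀ s s', |s| ≤ δ → |s'| ≤ δ → ‖α s - α s' - ((s - s' : ℝ) : ℂ) * V‖ ≤ κ * |s - s'|)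
    (hv : κ * ‖v‖ < |(v * starRingEnd ℂ V).im|) (hs : |s| ≤ δ) (hs' : |s'| ≤ δ) :
    α s ≠ α s' + v := by
  intro h
  have hcs := hα s s' hs hs'
  have heq : ((s - s' : ℝ) : ℂ) * V + ((-1 : ℝ) : ℂ) * v =
      -(α s - α s' - ((s - s' : ℝ) : ℂ) * V) := by
    rw [h]; push_cast; ring
  obtain ⟨h1, h2⟩ := abs_mul_im_le_of_eq heq
  rw [norm_neg] at h1 h2
  rw [abs_im_mul_conj_comm] at h1 h2
  rw [abs_neg, abs_one, one_mul] at h2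
  by_cases hss : s = s'
  · subst hss
    have h0 : ‖α s - α s - ((s - s : ℝ) : ℂ) * V‖ = 0 := by simp
    rw [h0, zero_mul] at h2
    nlinarith [abs_nonneg ((v * starRingEnd ℂ V).im), norm_nonneg v]
  · have hpos : 0 < |s - s'| := abs_pos.2 (sub_ne_zero.2 hss)
    have h3 : |s - s'| * |(v * starRingEnd ℂ V).im| ≤ |s - s'| * (κ * ‖v‖) := by
      calc _ ≤ ‖α s - α s' - ((s - s' : ℝ) : ℂ) * V‖ * ‖v‖ := h1
        _ ≤ κ * |s - s'| * ‖v‖ := mul_le_mul_of_nonneg_right hcs (norm_nonneg v)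
        _ = |s - s'| * (κ * ‖v‖) := by ring
    have := le_of_mul_le_mul_left h3 hpos
    linarith

/-- **A strand misses the points beside the other strand.** At a transversal crossing `y` of a
strand `β` (direction `U`, cone of slope `κ`) with a strand through `a' ≈ y + s' V`, the points
`a' + v` with `‖v‖` small compared with `|s'|` are not on `β` (within its window). [folklore] -/
theorem ne_add_of_cones {β : ℝ → ℂ} {y V U a' v : ℂ} {κ δ s s' : ℝ} (hκ0 : 0 ≤ κ)
    (hβ : ∀ s, |s| ≤ δ → ‖β s - y - (s : ℂ) * U‖ ≤ κ * |s|) (hs : |s| ≤ δ)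
    (ha' : ‖a' - y - (s' : ℂ) * V‖ ≤ κ * |s'|)
    (hκ : 2 * κ * (‖U‖ + ‖V‖) ≤ |(V * starRingEnd ℂ U).im|)
    (hv : 2 * ‖v‖ * (‖U‖ + ‖V‖) < |s'| * |(V * starRingEnd ℂ U).im|) : β s ≠ a' + v := by
  intro h
  set E := (β s - y - (s : ℂ) * U) - (a' - y - (s' : ℂ) * V) - v with hE
  have heq : (s' : ℂ) * V + ((-s : ℝ) : ℂ) * U = E := by
    rw [hE, h]; push_cast; ring
  obtain ⟨h1, h2⟩ := abs_mul_im_le_of_eq heq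
  rw [abs_neg] at h2
  set D := |(V * starRingEnd ℂ U).im| with hD
  have hEle : ‖E‖ ≤ κ * |s| + κ * |s'| + ‖v‖ := by
    have e1 := norm_sub_le ((β s - y - (s : ℂ) * U) - (a' - y - (s' : ℂ) * V)) v
    have e2 := norm_sub_le (β s - y - (s : ℂ) * U) (a' - y - (s' : ℂ) * V)
    linarith [hβ s hs]
  have hU := norm_nonneg U
  have hV := norm_nonneg V
  have hsum : (|s| + |s'|) * D ≤ (κ * |s| + κ * |s'| + ‖v‖) * (‖U‖ + ‖V‖) := by
    nlinarith [mul_le_mul_of_nonneg_right hEle hU, mul_le_mul_of_nonneg_right hEle hV]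
  nlinarith [abs_nonneg s, abs_nonneg s', norm_nonneg v, mul_nonneg hκ0 (abs_nonneg s),
    mul_nonneg (abs_nonneg s) (add_nonneg hU hV)]

/-- **A strand misses the points deep inside a quadrant.** If `α s ≈ y + s V` (cone of slope `κ`)
and `U` is transversal to `V`, then the points `y + x₁ V + x₂ U + e` with `|x₁| ≤ τ`,
`μ₁ τ ≤ |x₂|` and `‖e‖ ≤ κ τ` are not on `α` (within its window), for `κ` small. [folklore] -/
theorem ne_quadrant_of_cone {α : ℝ → ℂ} {y V U e : ℂ} {κ δ μ₁ τ x₁ x₂ s : ℝ} (hκ0 : 0 ≤ κ)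
    (hα : ∀ s, |s| ≤ δ → ‖α s - y - (s : ℂ) * V‖ ≤ κ * |s|) (hs : |s| ≤ δ)
    (hκU : 4 * κ * ‖U‖ ≤ |(V * starRingEnd ℂ U).im|)
    (hκV : 3 * κ * ‖V‖ < μ₁ * |(V * starRingEnd ℂ U).im|)
    (hτ : 0 < τ) (hx₁ : |x₁| ≤ τ) (hx₂ : μ₁ * τ ≤ |x₂|) (he : ‖e‖ ≤ κ * τ) :
    α s ≠ y + (x₁ : ℂ) * V + (x₂ : ℂ) * U + e := by
  intro h
  set E := e - (α s - y - (s : ℂ) * V) with hE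
  have heq : ((s - x₁ : ℝ) : ℂ) * V + ((-x₂ : ℝ) : ℂ) * U = E := by
    rw [hE, h]; push_cast; ring
  obtain ⟨h1, h2⟩ := abs_mul_im_le_of_eq heq
  rw [abs_neg] at h2
  set D := |(V * starRingEnd ℂ U).im| with hD
  have hEle : ‖E‖ ≤ κ * τ + κ * |s| := (norm_sub_le _ _).trans (add_le_add he (hα s hs))
  have hU := norm_nonneg U
  have hV := norm_nonneg V
  have hD0 : 0 ≤ D := abs_nonneg _
  -- `|s| ≤ 2 τ`
  have hs2 : |s| * D ≤ 2 * τ * D := by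
    have h3 : |s - x₁| * D ≤ (κ * τ + κ * |s|) * ‖U‖ := by
      nlinarith [mul_le_mul_of_nonneg_right hEle hU]
    have h4 : |s| ≤ |s - x₁| + |x₁| := by
      have := abs_add_le (s - x₁) x₁; rwa [sub_add_cancel] at this
    nlinarith [abs_nonneg (s - x₁), abs_nonneg s, mul_nonneg hκ0 hτ.le,
      mul_nonneg (mul_nonneg hκ0 (abs_nonneg s)) hU]
  have h5 : |x₂| * D ≤ (κ * τ + κ * |s|) * ‖V‖ := by
    nlinarith [mul_le_mul_of_nonneg_right hEle hV]
  have h6 : μ₁ * τ * D ≤ (κ * τ + κ * |s|) * ‖V‖ := by nlinarith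
  -- combine
  have h7 : κ * |s| * ‖V‖ * D ≤ κ * (2 * τ) * ‖V‖ * D := by
    have := mul_le_mul_of_nonneg_left hs2 (mul_nonneg hκ0 hV)
    nlinarith
  by_cases hDz : D = 0
  · rw [hDz, mul_zero] at hκV
    nlinarith
  · have hDp : 0 < D := lt_of_le_of_ne hD0 (Ne.symm hDz)
    have h8 : μ₁ * τ * D * D ≤ (κ * τ + κ * |s|) * ‖V‖ * D := mul_le_mul_of_nonneg_right h6 hD0
    nlinarith [mul_pos hτ hDp]

/-! ### Side conditions -/

/-- `Im ((i V) V̄) = ‖V‖²`. [folklore] -/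
theorem im_I_mul_mul_conj (V : ℂ) : (I * V * starRingEnd ℂ V).im = ‖V‖ ^ 2 := by
  rw [Complex.sq_norm, Complex.normSq_apply]
  simp [Complex.mul_im, Complex.mul_re]
  ring

/-- A convex combination of two numbers below `η` is below `η`. [folklore] -/
theorem convex_comb_lt {A B η μ : ℝ} (hA : A < η) (hB : B < η) (hμ0 : 0 ≤ μ) (hμ1 : μ ≤ 1) :
    (1 - μ) * A + μ * B < η := by
  rcases eq_or_lt_of_le hμ1 with rfl | hlt
  · linarith
  · nlinarith

/-- Scaling a side condition `κ ‖w‖ < σ Im (w V̄)` (`σ = ±1`: `w` points definitely to the left,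
resp. right, of `V`) by a positive real. [folklore] -/
theorem side_smul {κ σ ε : ℝ} {w V : ℂ} (hε : 0 < ε)
    (h : κ * ‖w‖ < σ * (w * starRingEnd ℂ V).im) :
    κ * ‖(ε : ℂ) * w‖ < σ * ((ε : ℂ) * w * starRingEnd ℂ V).im := by
  rw [norm_mul, Complex.norm_real, Real.norm_eq_abs, abs_of_pos hε, mul_assoc (ε : ℂ),
    Complex.im_ofReal_mul]
  nlinarith

/-- A side condition gives transversality: `κ ‖w‖ < |Im (w V̄)|`. [folklore] -/
theorem side_abs {κ σ : ℝ} {w V : ℂ} (hσ : σ = 1 ∨ σ = -1)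
    (h : κ * ‖w‖ < σ * (w * starRingEnd ℂ V).im) : κ * ‖w‖ < |(w * starRingEnd ℂ V).im| := by
  rcases hσ with rfl | rfl
  · rw [one_mul] at h; exact h.trans_le (le_abs_self _)
  · rw [neg_one_mul] at h; exact h.trans_le (neg_le_abs _)

end GaussParity


/-! ## 2. The plane curve of a knot missing the north pole is smooth -/

namespace Knot

/-- A point of `𝕊³` with last coordinate `1` is the north pole. [folklore] -/
theorem eq_northPole_of_apply_three {x : Metric.sphere (0 : EuclideanSpace ℝ (Fin 4)) 1}
    (h : (x : EuclideanSpace ℝ (Fin 4)) 3 = 1) : x = northPole := by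
  have hn : ‖(x : EuclideanSpace ℝ (Fin 4))‖ = 1 := by simp
  have hsq : ∑ i, ‖(x : EuclideanSpace ℝ (Fin 4)) i‖ ^ 2 = 1 := by
    rw [← EuclideanSpace.norm_sq_eq, hn, one_pow]
  simp only [Fin.sum_univ_four, Real.norm_eq_abs, sq_abs, h, one_pow] at hsq
  have h0 : (x : EuclideanSpace ℝ (Fin 4)) 0 = 0 := by nlinarith
  have h1 : (x : EuclideanSpace ℝ (Fin 4)) 1 = 0 := by nlinarith
  have h2 : (x : EuclideanSpace ℝ (Fin 4)) 2 = 0 := by nlinarith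
  refine Subtype.ext (PiLp.ext fun i => ?_)
  rw [coe_northPole]
  fin_cases i <;> simp [h0, h1, h2, h]

/-- **The plane curve of a knot missing the north pole is smooth** (the knot is a smooth map into
`𝕊³ ⊆ ℝ⁴`, the parametrisation `circlePoint` of `𝕊¹` is smooth, and the stereographic formula
`x ↦ ((1 - x₃)⁻¹ x₀, (1 - x₃)⁻¹ x₁)` is smooth off `x₃ = 1`). [folklore] -/
theorem contDiff_planeCurve_of_notMem {K : Knot} (hK : northPole ∉ range K) :
    ContDiff ℝ ∞ K.planeCurve := by
  haveI : Fact (Module.finrank ℝ (EuclideanSpace ℝ (Fin (1 + 1))) = 1 + 1) :=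
    ⟨finrank_euclideanSpace_fin⟩
  haveI : Fact (Module.finrank ℝ (EuclideanSpace ℝ (Fin (3 + 1))) = 3 + 1) :=
    ⟨finrank_euclideanSpace_fin⟩
  set c : ℝ → EuclideanSpace ℝ (Fin 4) := fun t =>
    ((K (circlePoint t) : Metric.sphere (0 : EuclideanSpace ℝ (Fin 4)) 1) :
      EuclideanSpace ℝ (Fin 4)) with hc_def
  have h1 : ContMDiff 𝓘(ℝ, ℝ) (𝓡 1) ∞ circlePoint :=
    contDiff_coe_circlePoint.contMDiff.codRestrict_sphere fun θ => (circlePoint θ).2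
  have h2 : ContMDiff 𝓘(ℝ, ℝ) 𝓘(ℝ, EuclideanSpace ℝ (Fin 4)) ∞ c :=
    (contMDiff_coe_sphere.comp K.contMDiff).comp h1
  have hc : ContDiff ℝ ∞ c := contMDiff_iff_contDiff.1 h2
  have hco : ∀ i, ContDiff ℝ ∞ fun t => c t i := contDiff_euclidean.1 hc
  have h3 : ∀ t, 1 - c t 3 ≠ 0 := by
    intro t ht
    have h' : c t 3 = 1 := by linarith
    exact hK ⟨circlePoint t, eq_northPole_of_apply_three h'⟩
  have hinv : ContDiff ℝ ∞ fun t => (1 - c t 3)⁻¹ := (contDiff_const.sub (hco 3)).inv h3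
  have : K.planeCurve = fun t => ((1 - c t 3)⁻¹ * c t 0, (1 - c t 3)⁻¹ * c t 1) := rfl
  rw [this]
  exact (hinv.mul (hco 0)).prodMk (hinv.mul (hco 1))

/-- Hence the complex velocity of such a knot is continuous. [folklore] -/
theorem continuous_cplaneDeriv_of_notMem {K : Knot} (hK : northPole ∉ range K) :
    Continuous K.cplaneDeriv := by
  have h := (contDiff_planeCurve_of_notMem hK).continuous_deriv (by simp)
  show Continuous fun t => Complex.equivRealProdCLM.symm (deriv K.planeCurve t)
  exact Complex.equivRealProdCLM.symm.continuous.comp h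

end Knot

/-! ## 3. The plane strands of a link, the trace, the total winding number -/

namespace Link

variable {ι : Type*} (L : Link ι)

/-- The **plane strand** of the component `a`: its stereographic plane curve read in `ℂ`.
[folklore] -/
def strand (a : ι) : ℝ → ℂ := (L.component a).cplaneCurve

/-- The complex velocity of the plane strand of the component `a`. [folklore] -/
def strandDeriv (a : ι) : ℝ → ℂ := (L.component a).cplaneDeriv

/-- The **trace** of the link projection: the union of the images of all plane strands.
[folklore] -/
def trace : Set ℂ := ⋃ a, range (L.strand a)

/-- The plane strand of the component `a` read as a loop on `[0, 1]` (one period). [folklore] -/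
def uloop (a : ι) (s : ℝ) : ℂ := L.strand a (2 * π * s)

/-- The **total winding number** of the link projection about the point `x`: the sum over the
components of the winding numbers of their plane strands (meaningful off the trace).
[folklore] -/
def windSum [Fintype ι] (x : ℂ) : ℤ := ∑ a, wind fun s => L.uloop a s - x

/-- The **left winding number** of the component `a` at the parameter `t`: the total winding
number about the points `γₐ t + ε i γₐ' t` just to the left of the strand, in the limit
`ε → 0⁺` (an eventual value at simple points, `leftWind_spec`). [folklore] -/
def leftWind [Fintype ι] (a : ι) (t : ℝ) : ℤ :=
  limUnder (𝓝[>] (0 : ℝ)) fun ε => L.windSum (L.strand a t + (ε : ℂ) * (I * L.strandDeriv a t))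

/-- The plane strands are `2π`-periodic. [folklore] -/
theorem periodic_strand (a : ι) : Periodic (L.strand a) (2 * π) :=
  (L.component a).periodic_cplaneCurve

/-- The velocities of the plane strands are `2π`-periodic. [folklore] -/
theorem periodic_strandDeriv (a : ι) : Periodic (L.strandDeriv a) (2 * π) :=
  (L.component a).periodic_cplaneDeriv

/-- Shifting the parameter by whole periods. [folklore] -/
theorem strand_add_int_mul (a : ι) (t : ℝ) (k : ℤ) :
    L.strand a (t + k * (2 * π)) = L.strand a t :=
  (L.periodic_strand a).int_mul k t

/-- Shifting the parameter by whole periods. [folklore] -/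
theorem strandDeriv_add_int_mul (a : ι) (t : ℝ) (k : ℤ) :
    L.strandDeriv a (t + k * (2 * π)) = L.strandDeriv a t :=
  (L.periodic_strandDeriv a).int_mul k t

/-- Equality of strand points is equality of points of the plane curves. [folklore] -/
theorem strand_eq_iff {a b : ι} {s t : ℝ} : L.strand a s = L.strand b t ↔
    (L.component a).planeCurve s = (L.component b).planeCurve t :=
  Complex.equivRealProdCLM.symm.injective.eq_iff

/-- Points of strands are on the trace. [folklore] -/
theorem strand_mem_trace (a : ι) (s : ℝ) : L.strand a s ∈ L.trace :=
  mem_iUnion.2 ⟨a, s, rfl⟩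

/-- Membership in the trace. [folklore] -/
theorem mem_trace {x : ℂ} : x ∈ L.trace ↔ ∃ a s, L.strand a s = x := by
  simp only [trace, mem_iUnion, mem_range]

/-- The loop on `[0, 1]` stays on the strand. [folklore] -/
theorem image_uloop_subset (a : ι) : L.uloop a '' Icc 0 1 ⊆ range (L.strand a) := by
  rintro _ ⟨s, -, rfl⟩; exact ⟨_, rfl⟩

/-- The loop on `[0, 1]` closes up. [folklore] -/
theorem uloop_zero_eq_one (a : ι) : L.uloop a 0 = L.uloop a 1 := by
  simp only [uloop, mul_zero, mul_one]
  have := L.periodic_strand a 0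
  rw [zero_add] at this
  exact this.symm

/-- The left winding number is `2π`-periodic in the parameter. [folklore] -/
theorem leftWind_add_int_mul [Fintype ι] (a : ι) (t : ℝ) (k : ℤ) :
    L.leftWind a (t + k * (2 * π)) = L.leftWind a t := by
  simp only [leftWind, strand_add_int_mul, strandDeriv_add_int_mul]

namespace RegularProjection

variable {L}

/-- The plane strands of a regular projection are differentiable, with velocity `strandDeriv`.
[folklore] -/
theorem hasDerivAt_strand (P : L.RegularProjection) (a : ι) (t : ℝ) :
    HasDerivAt (L.strand a) (L.strandDeriv a t) t := by
  have hd : HasDerivAt (L.component a).planeCurve (deriv (L.component a).planeCurve t) t :=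
    (differentiableAt_of_deriv_ne_zero (P.deriv_ne_zero a t)).hasDerivAt
  exact (Complex.equivRealProdCLM.symm : ℝ × ℝ →L[ℝ] ℂ).hasFDerivAt.comp_hasDerivAt t hd

/-- The plane strands are continuous. [folklore] -/
theorem continuous_strand (P : L.RegularProjection) (a : ι) : Continuous (L.strand a) :=
  continuous_iff_continuousAt.2 fun t => (P.hasDerivAt_strand a t).continuousAt

/-- The velocities of the plane strands are continuous (the plane curves are `C¹`). [folklore] -/
theorem continuous_strandDeriv (P : L.RegularProjection) (a : ι) : Continuous (L.strandDeriv a) :=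
  Knot.continuous_cplaneDeriv_of_notMem (P.northPole_notMem a)

/-- The velocities of the plane strands never vanish. [folklore] -/
theorem strandDeriv_ne_zero (P : L.RegularProjection) (a : ι) (t : ℝ) :
    L.strandDeriv a t ≠ 0 := fun h =>
  P.deriv_ne_zero a t (Complex.equivRealProdCLM.symm.injective (by
    rw [map_zero]; exact h))

/-- The loops on `[0, 1]` are continuous. [folklore] -/
theorem continuous_uloop (P : L.RegularProjection) (a : ι) : Continuous (L.uloop a) :=
  (P.continuous_strand a).comp (continuous_const.mul continuous_id)

/-- **The total winding number is constant along paths off the trace.** [folklore] -/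
theorem windSum_eq_of_path (P : L.RegularProjection) [Fintype ι] {c : ℝ → ℂ} {t₁ t₂ : ℝ}
    (ht : t₁ ≤ t₂)
    (hc : ContinuousOn c (Icc t₁ t₂)) (h : ∀ t ∈ Icc t₁ t₂, c t ∉ L.trace) :
    L.windSum (c t₁) = L.windSum (c t₂) := by
  unfold windSum
  refine Finset.sum_congr rfl fun a _ => ?_
  exact wind_sub_eq_of_path (P.continuous_uloop a).continuousOn (L.uloop_zero_eq_one a) ht hc
    fun t ht' hmem => h t ht' (mem_iUnion.2 ⟨a, L.image_uloop_subset a hmem⟩)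

/-- The total winding number agrees at the ends of a segment off the trace. [folklore] -/
theorem windSum_eq_of_segment (P : L.RegularProjection) [Fintype ι] {z₀ z₁ : ℂ}
    (h : ∀ μ ∈ Icc (0 : ℝ) 1, z₀ + (μ : ℂ) * (z₁ - z₀) ∉ L.trace) :
    L.windSum z₀ = L.windSum z₁ := by
  have := P.windSum_eq_of_path (c := fun μ : ℝ => z₀ + (μ : ℂ) * (z₁ - z₀)) zero_le_one
    (by fun_prop) h
  simpa using this

/-- The winding number of one strand agrees at the ends of a segment missing that strand.
[folklore] -/
theorem wind_uloop_eq_of_segment (P : L.RegularProjection) (a : ι) {z₀ z₁ : ℂ}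
    (h : ∀ μ ∈ Icc (0 : ℝ) 1, z₀ + (μ : ℂ) * (z₁ - z₀) ∉ range (L.strand a)) :
    wind (fun s => L.uloop a s - z₀) = wind (fun s => L.uloop a s - z₁) := by
  have := wind_sub_eq_of_path (P.continuous_uloop a).continuousOn (L.uloop_zero_eq_one a)
    (c := fun μ : ℝ => z₀ + (μ : ℂ) * (z₁ - z₀)) zero_le_one (by fun_prop)
    fun t _ hmem => h t ‹_› (L.image_uloop_subset a hmem)
  simpa using this

/-- **Re-basing a strand.** The winding number about `x` of the strand of `a`, read on one period
centred at the parameter `t`, is that of `uloop a` (rotation invariance). [folklore] -/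
theorem wind_strand_rebase (P : L.RegularProjection) (a : ι) {x : ℂ}
    (hx : x ∉ range (L.strand a)) (t : ℝ) :
    wind (fun s => L.strand a (t + 2 * π * (s - 1 / 2)) - x) =
      wind (fun s => L.uloop a s - x) := by
  have hne : ∀ s, L.uloop a s - x ≠ 0 := fun s h => hx ⟨_, (sub_eq_zero.1 h)⟩
  have hp : Periodic (fun s => L.uloop a s - x) 1 := fun s => by
    simp only [uloop]
    rw [show 2 * π * (s + 1) = 2 * π * s + 2 * π by ring, L.periodic_strand a]
  have := Literature.Topology.PlaneTopology.wind_comp_add_of_periodic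
    (f := fun s => L.uloop a s - x)
    ((P.continuous_uloop a).sub continuous_const) hne hp (t / (2 * π) - 1 / 2)
  rw [← this]
  congr 1
  ext s
  simp only [uloop]
  congr 2
  field_simp
  ring

/-- **Far from the listed passages a point is far from the trace.** If every parameter at which
some strand passes through `y` is listed in `Z` (modulo `2π`), then for every `δ > 0` there is
`η > 0` such that the strands come `η`-close to `y` only at parameters `δ`-close (modulo `2π`) to
a listed one (compactness of a period). [folklore] -/
theorem exists_far (P : L.RegularProjection) [Fintype ι] {y : ℂ} {Z : Finset (ι × ℝ)}
    (hZ : ∀ c s, L.strand c s = y → ∃ z ∈ Z, z.1 = c ∧ ∃ k : ℤ, s = z.2 + k * (2 * π))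
    {δ : ℝ} (hδ : 0 < δ) :
    ∃ η > 0, ∀ c s, ‖L.strand c s - y‖ < η →
      ∃ z ∈ Z, z.1 = c ∧ ∃ k : ℤ, |s - z.2 - k * (2 * π)| < δ := by
  classical
  set S : ι → Set ℝ := fun c => Icc 0 (2 * π) ∩
    ⋂ z ∈ Z, ⋂ (_ : z.1 = c), ⋂ k : ℤ, {s | δ ≤ |s - z.2 - k * (2 * π)|} with hS
  have hSc : ∀ c, IsCompact (S c) := fun c =>
    isCompact_Icc.inter_right (isClosed_biInter fun z _ => isClosed_iInter fun _ =>
      isClosed_iInter fun k => isClosed_le continuous_const (by fun_prop))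
  have hne : ∀ c, ∀ s ∈ S c, L.strand c s ≠ y := by
    intro c s hs h
    obtain ⟨z, hz, hzc, k, hk⟩ := hZ c s h
    have h0 := hs.2
    simp only [mem_iInter, mem_setOf_eq] at h0
    have := h0 z hz hzc k
    rw [hk, show z.2 + k * (2 * π) - z.2 - k * (2 * π) = 0 by ring, abs_zero] at this
    exact absurd this (not_le.2 hδ)
  have hη : ∀ c, ∃ η > 0, ∀ s ∈ S c, η ≤ ‖L.strand c s - y‖ := fun c =>
    exists_pos_forall_le_norm_sub (hSc c) (P.continuous_strand c).continuousOn (hne c)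
  choose η hη0 hηle using hη
  have hev : ∀ᶠ e in 𝓝[>] (0 : ℝ), 0 < e ∧ ∀ c, e < η c :=
    (eventually_mem_nhdsWithin).and (eventually_all.2 fun c =>
      mem_of_superset (Ioo_mem_nhdsGT (hη0 c)) fun e he => he.2)
  obtain ⟨e, he0, he⟩ := hev.exists
  refine ⟨e, he0, fun c s hs => ?_⟩
  have h2π : (0 : ℝ) < 2 * π := by positivity
  set s₀ := toIcoMod h2π 0 s with hs₀
  have hmem₀ : s₀ ∈ Ico (0 : ℝ) (0 + 2 * π) := toIcoMod_mem_Ico h2π 0 s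
  set m : ℤ := toIcoDiv h2π 0 s with hm
  have hsm : s₀ = s - m * (2 * π) := by
    rw [hs₀, toIcoMod, hm, zsmul_eq_mul]
  have hval : L.strand c s₀ = L.strand c s := by
    rw [hsm, show s - m * (2 * π) = s + ((-m : ℤ) : ℝ) * (2 * π) by push_cast; ring,
      L.strand_add_int_mul]
  by_contra hcon
  push Not at hcon
  have hmemS : s₀ ∈ S c := by
    refine ⟨⟨hmem₀.1, by linarith [hmem₀.2]⟩, ?_⟩
    simp only [mem_iInter, mem_setOf_eq]
    intro z hz hzc k
    have := hcon z hz hzc (k + m)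
    rw [hsm]
    push_cast at this ⊢
    rwa [show s - m * (2 * π) - z.2 - k * (2 * π) = s - z.2 - (k + m) * (2 * π) by ring]
  have := hηle c s₀ hmemS
  rw [hval] at this
  linarith [he c]

end RegularProjection

end Link

namespace Link

variable {ι : Type*} (L : Link ι)

/-! ## 4. Simple points, local frames and the left winding number -/

/-! ### Simple points of the trace and local frames -/

/-- The parameter `t` of the component `a` is a **simple point** of the projection: the only
passages of strands through `γₐ t` are those of `γₐ` at parameters congruent to `t`.
[folklore] -/
def IsSimplePt (a : ι) (t : ℝ) : Prop :=
  ∀ c s, L.strand c s = L.strand a t → c = a ∧ ∃ k : ℤ, s = t + k * (2 * π)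

/-- A **local frame** of the trace at the parameter `t` of the component `a`, of slope `κ`,
window `δ` and radius `η`: on the window the strand stays in the cone of slope `κ` around its
tangent direction `V = γₐ' t` (uniformly: any two points), its velocity stays within `κ` of `V`,
and the strands come `η`-close to `γₐ t` only on that window (modulo `2π`). [folklore] -/
structure IsSimpleFrame (a : ι) (t κ δ η : ℝ) : Prop where
  /-- The window is non-degenerate. -/
  δ_pos : 0 < δ
  /-- The window is shorter than a period. -/
  δ_le : δ ≤ 1
  /-- The radius is positive. -/
  η_pos : 0 < η
  /-- The uniform cone estimate on the window. -/
  cone : ∀ s s', |s| ≤ δ → |s'| ≤ δ → ‖L.strand a (t + s) - L.strand a (t + s') -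
    ((s - s' : ℝ) : ℂ) * L.strandDeriv a t‖ ≤ κ * |s - s'|
  /-- The velocity stays near `V`. -/
  vel : ∀ s, |s| ≤ δ → ‖L.strandDeriv a (t + s) - L.strandDeriv a t‖ ≤ κ
  /-- Strands come close to the point only on the window. -/
  far : ∀ c u, ‖L.strand c u - L.strand a t‖ < η → c = a ∧ ∃ k : ℤ, |u - t - k * (2 * π)| < δ

variable {L}

namespace IsSimpleFrame

variable {a : ι} {t κ δ η : ℝ}

/-- **Points beside the strand are off the trace**: `γₐ (t + s') + v ∉ trace` for `s'` in the
window and `v` pointing definitely across the strand, close to the point. [folklore] -/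
theorem add_notMem (hF : L.IsSimpleFrame a t κ δ η) (hκ0 : 0 ≤ κ) {s' : ℝ} (hs' : |s'| ≤ δ)
    {v : ℂ} (hv : κ * ‖v‖ < |(v * starRingEnd ℂ (L.strandDeriv a t)).im|)
    (hη : ‖L.strand a (t + s') - L.strand a t‖ + ‖v‖ < η) :
    L.strand a (t + s') + v ∉ L.trace := by
  intro hmem
  obtain ⟨c, u, hu⟩ := L.mem_trace.1 hmem
  have hclose : ‖L.strand c u - L.strand a t‖ < η := by
    rw [hu, show L.strand a (t + s') + v - L.strand a t = (L.strand a (t + s') - L.strand a t) + v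
      by ring]
    exact (norm_add_le _ _).trans_lt hη
  obtain ⟨rfl, k, hk⟩ := hF.far c u hclose
  set s := u - t - k * (2 * π) with hs
  have hus : L.strand c u = L.strand c (t + s) := by
    rw [show u = t + s + k * (2 * π) by rw [hs]; ring, L.strand_add_int_mul]
  rw [hus] at hu
  exact ne_add_of_window_cone hκ0 hF.cone hv hk.le hs' hu

/-- **All points on one side agree.** The total winding number takes the same value at
`γₐ (t + s') + v₁` and `γₐ (t + s') + v₂` when `v₁`, `v₂` point definitely to the same side `σ`
of the strand (the segment between them misses the trace). [folklore] -/
theorem windSum_add_eq [Fintype ι] (hF : L.IsSimpleFrame a t κ δ η) (P : L.RegularProjection)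
    (hκ0 : 0 ≤ κ) {s' : ℝ} (hs' : |s'| ≤ δ) {σ : ℝ} (hσ : σ = 1 ∨ σ = -1) {v₁ v₂ : ℂ}
    (h₁ : κ * ‖v₁‖ < σ * (v₁ * starRingEnd ℂ (L.strandDeriv a t)).im)
    (h₂ : κ * ‖v₂‖ < σ * (v₂ * starRingEnd ℂ (L.strandDeriv a t)).im)
    (hη₁ : ‖L.strand a (t + s') - L.strand a t‖ + ‖v₁‖ < η)
    (hη₂ : ‖L.strand a (t + s') - L.strand a t‖ + ‖v₂‖ < η) :
    L.windSum (L.strand a (t + s') + v₁) = L.windSum (L.strand a (t + s') + v₂) := by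
  refine P.windSum_eq_of_segment fun μ hμ => ?_
  set V := L.strandDeriv a t with hV
  set w := v₁ + (μ : ℂ) * (v₂ - v₁) with hw
  have hpt : L.strand a (t + s') + v₁ + (μ : ℂ) * (L.strand a (t + s') + v₂ -
      (L.strand a (t + s') + v₁)) = L.strand a (t + s') + w := by rw [hw]; ring
  rw [hpt]
  obtain ⟨hμ0, hμ1⟩ := hμ
  have hnorm : ‖w‖ ≤ (1 - μ) * ‖v₁‖ + μ * ‖v₂‖ := by
    have e : w = ((1 - μ : ℝ) : ℂ) * v₁ + (μ : ℂ) * v₂ := by rw [hw]; push_cast; ring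
    rw [e]
    refine (norm_add_le _ _).trans ?_
    rw [norm_mul, norm_mul, Complex.norm_real, Complex.norm_real, Real.norm_eq_abs,
      Real.norm_eq_abs, abs_of_nonneg (by linarith), abs_of_nonneg hμ0]
  have him : (w * starRingEnd ℂ V).im = (1 - μ) * (v₁ * starRingEnd ℂ V).im +
      μ * (v₂ * starRingEnd ℂ V).im := by
    rw [hw]
    simp only [add_mul, sub_mul, Complex.add_im, Complex.sub_im, mul_assoc, Complex.im_ofReal_mul]
    ring
  have hpos : (1 - μ) * (κ * ‖v₁‖ - σ * (v₁ * starRingEnd ℂ V).im) +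
      μ * (κ * ‖v₂‖ - σ * (v₂ * starRingEnd ℂ V).im) < 0 :=
    convex_comb_lt (by linarith) (by linarith) hμ0 hμ1
  refine hF.add_notMem hκ0 hs' (side_abs hσ ?_) ?_
  · have : σ * (w * starRingEnd ℂ V).im = (1 - μ) * (σ * (v₁ * starRingEnd ℂ V).im) +
        μ * (σ * (v₂ * starRingEnd ℂ V).im) := by rw [him]; ring
    rw [this]
    nlinarith [mul_nonneg hκ0 (norm_nonneg w)]
  · have := convex_comb_lt hη₁ hη₂ hμ0 hμ1
    nlinarith [norm_nonneg (L.strand a (t + s') - L.strand a t)]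

/-- Distance of a point of the window from the base point. [folklore] -/
theorem norm_strand_sub_le (hF : L.IsSimpleFrame a t κ δ η) {s : ℝ} (hs : |s| ≤ δ) :
    ‖L.strand a (t + s) - L.strand a t‖ ≤ (κ + ‖L.strandDeriv a t‖) * |s| := by
  have h := hF.cone s 0 hs (by rw [abs_zero]; exact hF.δ_pos.le)
  simp only [add_zero, sub_zero] at h
  calc ‖L.strand a (t + s) - L.strand a t‖
      = ‖(L.strand a (t + s) - L.strand a t - (s : ℂ) * L.strandDeriv a t) +
          (s : ℂ) * L.strandDeriv a t‖ := by rw [sub_add_cancel]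
    _ ≤ κ * |s| + ‖(s : ℂ) * L.strandDeriv a t‖ := (norm_add_le _ _).trans (by linarith)
    _ = (κ + ‖L.strandDeriv a t‖) * |s| := by
        rw [norm_mul, Complex.norm_real, Real.norm_eq_abs]; ring

end IsSimpleFrame

namespace RegularProjection

/-- **Local frames exist at simple points**, for every slope `κ > 0` (uniform cone by the mean
value inequality and the continuity of the velocity; far-ness by compactness, `exists_far`).
[folklore] -/
theorem exists_isSimpleFrame (P : L.RegularProjection) [Fintype ι] {a : ι} {t : ℝ}
    (h : L.IsSimplePt a t) {κ : ℝ} (hκ : 0 < κ) : ∃ δ η, L.IsSimpleFrame a t κ δ η := by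
  obtain ⟨δ₁, hδ₁, hcone, hvel⟩ := exists_window_cone (P.hasDerivAt_strand a)
    ((P.continuous_strandDeriv a).continuousAt (x := t)) hκ
  set δ := min δ₁ 1 with hδ
  have hδ0 : 0 < δ := lt_min hδ₁ one_pos
  have hZ : ∀ c s, L.strand c s = L.strand a t →
      ∃ z ∈ ({(a, t)} : Finset (ι × ℝ)), z.1 = c ∧ ∃ k : ℤ, s = z.2 + k * (2 * π) := by
    intro c s hs
    obtain ⟨rfl, k, hk⟩ := h c s hs
    exact ⟨(c, t), Finset.mem_singleton_self _, rfl, k, hk⟩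
  obtain ⟨η, hη, hfar⟩ := P.exists_far hZ hδ0
  refine ⟨δ, η, ⟨hδ0, min_le_right _ _, hη, fun s s' hs hs' => ?_, fun s hs => ?_,
    fun c u hu => ?_⟩⟩
  · have := hcone (t + s) (t + s') (by simpa using hs.trans (min_le_left _ _))
      (by simpa using hs'.trans (min_le_left _ _))
    rwa [add_sub_add_left_eq_sub] at this
  · have := hvel (t + s) (by simpa using hs.trans (min_le_left _ _))
    exact this
  · obtain ⟨z, hz, hzc, k, hk⟩ := hfar c u hu
    rw [Finset.mem_singleton] at hz
    subst hz
    exact ⟨hzc.symm, k, hk⟩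

/-! ### The left winding number at a simple point -/

/-- **The left winding number is an eventual value**: for all small `ε > 0` the total winding
number about `γₐ t + ε i γₐ' t` is `leftWind a t`. [folklore] -/
theorem leftWind_spec (P : L.RegularProjection) [Fintype ι] {a : ι} {t : ℝ}
    (h : L.IsSimplePt a t) : ∀ᶠ ε : ℝ in 𝓝[>] 0,
      L.windSum (L.strand a t + (ε : ℂ) * (I * L.strandDeriv a t)) = L.leftWind a t := by
  set V := L.strandDeriv a t with hV
  set y := L.strand a t with hy
  have hV0 : V ≠ 0 := P.strandDeriv_ne_zero a t
  have hVn : 0 < ‖V‖ := norm_pos_iff.2 hV0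
  obtain ⟨δ, η, hF⟩ := P.exists_isSimpleFrame h (half_pos hVn)
  have hside : ‖V‖ / 2 * ‖I * V‖ < 1 * (I * V * starRingEnd ℂ V).im := by
    rw [im_I_mul_mul_conj, norm_mul, Complex.norm_I, one_mul, one_mul]; nlinarith
  set ε₁ := η / (2 * ‖V‖) with hε₁
  have hε₁0 : 0 < ε₁ := div_pos hF.η_pos (by positivity)
  have hε₁η : ε₁ * ‖V‖ < η := by
    rw [hε₁, div_mul_eq_mul_div, div_lt_iff₀ (by positivity)]; nlinarith [hF.η_pos]
  have key : ∀ ε ∈ Ioo (0 : ℝ) ε₁, L.windSum (y + (ε : ℂ) * (I * V)) =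
      L.windSum (y + (ε₁ : ℂ) * (I * V)) := by
    intro ε hε
    have h0 : |(0 : ℝ)| ≤ δ := by rw [abs_zero]; exact hF.δ_pos.le
    have := hF.windSum_add_eq P (half_pos hVn).le h0 (Or.inl rfl) (side_smul hε.1 hside)
      (side_smul hε₁0 hside)
    simp only [add_zero, sub_self, norm_zero, zero_add, norm_mul, Complex.norm_real,
      Real.norm_eq_abs, Complex.norm_I, one_mul, abs_of_pos hε.1, abs_of_pos hε₁0] at this
    exact this (by nlinarith [hε.2]) hε₁η
  have hev : ∀ᶠ ε : ℝ in 𝓝[>] 0, L.windSum (y + (ε : ℂ) * (I * V)) =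
      L.windSum (y + (ε₁ : ℂ) * (I * V)) :=
    mem_of_superset (Ioo_mem_nhdsGT hε₁0) key
  have hlim : L.leftWind a t = L.windSum (y + (ε₁ : ℂ) * (I * V)) :=
    (tendsto_const_nhds.congr' (EventuallyEq.symm hev)).limUnder_eq
  rw [hlim]
  exact hev

/-- **Any direction strictly to the left computes the left winding number**: if
`Im (w γₐ'‾ t) > 0` then the total winding number about `γₐ t + ε w` is `leftWind a t` for all
small `ε > 0`. [folklore] -/
theorem windSum_add_eq_leftWind (P : L.RegularProjection) [Fintype ι] {a : ι} {t : ℝ}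
    (h : L.IsSimplePt a t) {w : ℂ} (hw : 0 < (w * starRingEnd ℂ (L.strandDeriv a t)).im) :
    ∀ᶠ ε : ℝ in 𝓝[>] 0,
      L.windSum (L.strand a t + (ε : ℂ) * w) = L.leftWind a t := by
  set V := L.strandDeriv a t with hV
  set y := L.strand a t with hy
  have hV0 : V ≠ 0 := P.strandDeriv_ne_zero a t
  have hVn : 0 < ‖V‖ := norm_pos_iff.2 hV0
  have hw0 : w ≠ 0 := by rintro rfl; simp at hw
  have hwn : 0 < ‖w‖ := norm_pos_iff.2 hw0
  set κ := min (‖V‖ / 2) ((w * starRingEnd ℂ V).im / (2 * ‖w‖)) with hκ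
  have hκ0 : 0 < κ := lt_min (half_pos hVn) (div_pos hw (by positivity))
  obtain ⟨δ, η, hF⟩ := P.exists_isSimpleFrame h hκ0
  have hsideV : κ * ‖I * V‖ < 1 * (I * V * starRingEnd ℂ V).im := by
    rw [im_I_mul_mul_conj, norm_mul, Complex.norm_I, one_mul, one_mul]
    have := min_le_left (‖V‖ / 2) ((w * starRingEnd ℂ V).im / (2 * ‖w‖))
    nlinarith
  have hsidew : κ * ‖w‖ < 1 * (w * starRingEnd ℂ V).im := by
    have h1 := min_le_right (‖V‖ / 2) ((w * starRingEnd ℂ V).im / (2 * ‖w‖))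
    rw [← hκ] at h1
    have h2 : (w * starRingEnd ℂ V).im / (2 * ‖w‖) * ‖w‖ = (w * starRingEnd ℂ V).im / 2 := by
      field_simp
    nlinarith [mul_le_mul_of_nonneg_right h1 hwn.le]
  set ε₁ := η / (2 * (‖V‖ + ‖w‖)) with hε₁
  have hε₁0 : 0 < ε₁ := div_pos hF.η_pos (by positivity)
  have hε₁η : ε₁ * (‖V‖ + ‖w‖) < η := by
    rw [hε₁, div_mul_eq_mul_div, div_lt_iff₀ (by positivity)]; nlinarith [hF.η_pos]
  have key : ∀ ε ∈ Ioo (0 : ℝ) ε₁, L.windSum (y + (ε : ℂ) * w) =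
      L.windSum (y + (ε : ℂ) * (I * V)) := by
    intro ε hε
    have h0 : |(0 : ℝ)| ≤ δ := by rw [abs_zero]; exact hF.δ_pos.le
    have := hF.windSum_add_eq P hκ0.le h0 (Or.inl rfl) (side_smul hε.1 hsidew)
      (side_smul hε.1 hsideV)
    simp only [add_zero, sub_self, norm_zero, zero_add, norm_mul, Complex.norm_real,
      Real.norm_eq_abs, Complex.norm_I, one_mul, abs_of_pos hε.1] at this
    exact this (by nlinarith [hε.2, hε.1]) (by nlinarith [hε.2, hε.1])
  filter_upwards [mem_of_superset (Ioo_mem_nhdsGT hε₁0) key, P.leftWind_spec h] with ε h1 h2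
  rw [h1, h2]

/-- **The jump across a strand at a simple point is exactly one**: the total winding number
just to the left exceeds that just to the right by `1` (the strand of `a` jumps by one,
`GaussParity.wind_sub_wind_eq_one`; the other strands are far). [folklore] -/
theorem windSum_left_sub_right (P : L.RegularProjection) [Fintype ι] {a : ι} {t : ℝ}
    (h : L.IsSimplePt a t) : ∀ᶠ ε : ℝ in 𝓝[>] 0,
      L.windSum (L.strand a t + (ε : ℂ) * (I * L.strandDeriv a t)) -
        L.windSum (L.strand a t - (ε : ℂ) * (I * L.strandDeriv a t)) = 1 := by
  classical
  set V := L.strandDeriv a t with hV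
  set y := L.strand a t with hy
  have hV0 : V ≠ 0 := P.strandDeriv_ne_zero a t
  have hVn : 0 < ‖V‖ := norm_pos_iff.2 hV0
  set κ := ‖V‖ / 16 with hκ
  have hκ0 : 0 < κ := by positivity
  obtain ⟨δ, η, hF⟩ := P.exists_isSimpleFrame h hκ0
  have hπ := Real.pi_pos
  have hπ2 := Real.two_le_pi
  have hπ4 := Real.pi_le_four
  -- the re-based loop
  set Λ : ℝ → ℂ := fun s => L.strand a (t + 2 * π * (s - 1 / 2)) with hΛ
  have hΛc : Continuous Λ := (P.continuous_strand a).comp (by fun_prop)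
  have h01 : Λ 0 = Λ 1 := by
    simp only [hΛ]
    rw [show t + 2 * π * ((1 : ℝ) - 1 / 2) = t + 2 * π * (0 - 1 / 2) + 2 * π by ring,
      L.periodic_strand]
  have hΛy : Λ (1 / 2) = y := by simp [hΛ, hy]
  set VΛ : ℂ := ((2 * π : ℝ) : ℂ) * V with hVΛ
  set w : ℂ := I * V with hw
  set δE := δ / (2 * π) with hδE
  have hδE0 : 0 < δE := div_pos hF.δ_pos (by positivity)
  have hδE1 : δE < 1 / 2 := by
    rw [hδE, div_lt_iff₀ (by positivity)]; linarith [hF.δ_le]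
  have hcone : ∀ s, |s - 1 / 2| ≤ δE →
      ‖Λ s - y - ((s - 1 / 2 : ℝ) : ℂ) * VΛ‖ ≤ 2 * π * κ * |s - 1 / 2| := by
    intro s hs
    have hu : |2 * π * (s - 1 / 2)| ≤ δ := by
      rw [abs_mul, abs_of_pos (by positivity : (0 : ℝ) < 2 * π)]
      rw [hδE, le_div_iff₀ (by positivity)] at hs
      linarith
    have := hF.cone (2 * π * (s - 1 / 2)) 0 hu (by rw [abs_zero]; exact hF.δ_pos.le)
    simp only [add_zero, sub_zero] at this
    rw [abs_mul, abs_of_pos (by positivity : (0 : ℝ) < 2 * π)] at this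
    have e1 : Λ s - y - ((s - 1 / 2 : ℝ) : ℂ) * VΛ = L.strand a (t + 2 * π * (s - 1 / 2)) -
        L.strand a t - ((2 * π * (s - 1 / 2) : ℝ) : ℂ) * V := by
      simp only [hΛ, hy, hVΛ]; push_cast; ring
    have e2 : 2 * π * κ * |s - 1 / 2| = κ * (2 * π * |s - 1 / 2|) := by ring
    rw [e1, e2]
    exact this
  have hfar : ∀ s ∈ Icc (0 : ℝ) 1, δE ≤ |s - 1 / 2| → η ≤ ‖Λ s - y‖ := by
    intro s hs hsδ
    by_contra hlt
    push Not at hlt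
    obtain ⟨-, k, hk⟩ := hF.far a (t + 2 * π * (s - 1 / 2)) hlt
    rw [add_sub_cancel_left] at hk
    by_cases hk0 : k = 0
    · subst hk0
      simp only [Int.cast_zero, zero_mul, sub_zero, abs_mul,
        abs_of_pos (by positivity : (0 : ℝ) < 2 * π)] at hk
      rw [hδE, div_le_iff₀ (by positivity)] at hsδ
      linarith
    · have hk1 : (1 : ℝ) ≤ |(k : ℝ)| := by
        rw [← Int.cast_abs]; exact_mod_cast Int.one_le_abs hk0
      have hs' : |s - 1 / 2| ≤ 1 / 2 := by
        rw [abs_le]; constructor <;> linarith [hs.1, hs.2]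
      have h1 : |(k : ℝ) * (2 * π)| ≤
          |2 * π * (s - 1 / 2) - k * (2 * π)| + |2 * π * (s - 1 / 2)| := by
        have := abs_sub_abs_le_abs_sub ((k : ℝ) * (2 * π)) (2 * π * (s - 1 / 2))
        rw [abs_sub_comm] at this
        linarith
      have h2 : |2 * π * (s - 1 / 2)| ≤ π := by
        rw [abs_mul, abs_of_pos (by positivity : (0 : ℝ) < 2 * π)]; nlinarith
      rw [abs_mul, abs_of_pos (by positivity : (0 : ℝ) < 2 * π)] at h1
      have h3 := mul_le_mul_of_nonneg_right hk1 (by positivity : (0 : ℝ) ≤ 2 * π)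
      linarith [hF.δ_le]
  have hκE : 2 * π * κ * (‖VΛ‖ + ‖w‖) < |(VΛ * starRingEnd ℂ w).im| := by
    have him : (VΛ * starRingEnd ℂ w).im = -(2 * π * ‖V‖ ^ 2) := by
      rw [hVΛ, hw, mul_assoc, Complex.im_ofReal_mul]
      have : (V * starRingEnd ℂ (I * V)).im = -‖V‖ ^ 2 := by
        rw [← im_I_mul_mul_conj V, map_mul, Complex.conj_I]
        simp only [Complex.mul_im, Complex.mul_re, Complex.neg_re, Complex.neg_im,
          Complex.I_re, Complex.I_im]
        ring
      rw [this]; ring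
    rw [him, abs_neg, abs_of_pos (by positivity), hVΛ, hw, norm_mul, norm_mul,
      Complex.norm_real, Real.norm_eq_abs, abs_of_pos (by positivity : (0 : ℝ) < 2 * π),
      Complex.norm_I, one_mul, hκ]
    have hX : 0 < π * ‖V‖ ^ 2 := by positivity
    nlinarith [mul_le_mul_of_nonneg_right hπ4 hX.le]
  have hneg : (VΛ * starRingEnd ℂ w).im < 0 := by
    rw [hVΛ, hw, mul_assoc, Complex.im_ofReal_mul]
    have : (V * starRingEnd ℂ (I * V)).im = -‖V‖ ^ 2 := by
      rw [← im_I_mul_mul_conj V, map_mul, Complex.conj_I]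
      simp only [Complex.mul_im, Complex.mul_re, Complex.neg_re, Complex.neg_im,
        Complex.I_re, Complex.I_im]
      ring
    rw [this]
    have hX : 0 < π * ‖V‖ ^ 2 := by positivity
    linarith
  -- points `y ± ν w` are off the trace for `0 < |ν|`, `|ν| ‖V‖ < η`
  have hoff : ∀ ν : ℝ, ν ≠ 0 → |ν| * ‖V‖ < η → y + (ν : ℂ) * w ∉ L.trace := by
    intro ν hν hνη
    have h0 : |(0 : ℝ)| ≤ δ := by rw [abs_zero]; exact hF.δ_pos.le
    have := hF.add_notMem hκ0.le h0 (v := (ν : ℂ) * w) ?_ ?_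
    · simpa [hy] using this
    · rw [norm_mul, Complex.norm_real, Real.norm_eq_abs, mul_assoc, Complex.im_ofReal_mul,
        abs_mul, hw, im_I_mul_mul_conj, norm_mul, Complex.norm_I, one_mul, abs_of_pos
        (by positivity : (0 : ℝ) < ‖V‖ ^ 2), hκ]
      have : 0 < |ν| * ‖V‖ ^ 2 := mul_pos (abs_pos.2 hν) (by positivity)
      nlinarith
    · simp only [add_zero, sub_self, norm_zero, zero_add, norm_mul, Complex.norm_real,
        Real.norm_eq_abs, hw, Complex.norm_I, one_mul]
      exact hνη
  set ε₁ := η / (2 * ‖V‖) with hε₁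
  have hε₁0 : 0 < ε₁ := div_pos hF.η_pos (by positivity)
  have hε₁η : ε₁ * ‖V‖ < η := by
    rw [hε₁, div_mul_eq_mul_div, div_lt_iff₀ (by positivity)]; nlinarith [hF.η_pos]
  filter_upwards [Ioo_mem_nhdsGT hε₁0] with ε hε
  obtain ⟨hε0, hεε₁⟩ := hε
  have hεη : ε * ‖V‖ < η := by nlinarith
  have hεw : ε * ‖w‖ < η := by rw [hw, norm_mul, Complex.norm_I, one_mul]; exact hεη
  -- the strand of `a`
  have hjump := wind_sub_wind_eq_one hΛc h01 hδE0 hδE1 (by linarith) hΛy hcone hfar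
    (by positivity) hκE hneg hε0 hεw
  have hplus : y + (ε : ℂ) * w ∉ L.trace := hoff ε hε0.ne' (by rwa [abs_of_pos hε0])
  have hminus : y - (ε : ℂ) * w ∉ L.trace := by
    have := hoff (-ε) (by linarith) (by rwa [abs_neg, abs_of_pos hε0])
    push_cast at this
    rwa [neg_mul, ← sub_eq_add_neg] at this
  have hra : ∀ {x}, x ∉ L.trace → x ∉ range (L.strand a) := fun hx hx' =>
    hx (mem_iUnion.2 ⟨a, hx'⟩)
  rw [P.wind_strand_rebase a (hra hplus), P.wind_strand_rebase a (hra hminus)] at hjump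
  -- the other strands
  have hother : ∀ c, c ≠ a → wind (fun s => L.uloop c s - (y - (ε : ℂ) * w)) =
      wind (fun s => L.uloop c s - (y + (ε : ℂ) * w)) := by
    intro c hc
    refine P.wind_uloop_eq_of_segment c fun μ hμ hmem => ?_
    have e : y - (ε : ℂ) * w + (μ : ℂ) * (y + (ε : ℂ) * w - (y - (ε : ℂ) * w)) =
        y + (((2 * μ - 1) * ε : ℝ) : ℂ) * w := by push_cast; ring
    rw [e] at hmem
    by_cases hν : (2 * μ - 1) * ε = 0
    · rw [hν] at hmem
      simp only [Complex.ofReal_zero, zero_mul, add_zero] at hmem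
      obtain ⟨u, hu⟩ := hmem
      exact hc (h c u hu).1
    · refine hoff _ hν ?_ (mem_iUnion.2 ⟨c, hmem⟩)
      have : |(2 * μ - 1) * ε| ≤ ε := by
        rw [abs_mul, abs_of_pos hε0]
        have : |2 * μ - 1| ≤ 1 := by rw [abs_le]; constructor <;> linarith [hμ.1, hμ.2]
        nlinarith
      nlinarith
  unfold windSum
  rw [← Finset.sum_sub_distrib, Finset.sum_eq_single a (fun c _ hc => by
    rw [hother c hc, sub_self]) (fun ha => absurd (Finset.mem_univ a) ha)]
  simpa [hw] using hjump

/-- **Any direction strictly to the right computes the left winding number minus one.**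
[folklore] -/
theorem windSum_add_eq_leftWind_sub_one (P : L.RegularProjection) [Fintype ι] {a : ι} {t : ℝ}
    (h : L.IsSimplePt a t) {w : ℂ} (hw : (w * starRingEnd ℂ (L.strandDeriv a t)).im < 0) :
    ∀ᶠ ε : ℝ in 𝓝[>] 0,
      L.windSum (L.strand a t + (ε : ℂ) * w) = L.leftWind a t - 1 := by
  set V := L.strandDeriv a t with hV
  set y := L.strand a t with hy
  have hV0 : V ≠ 0 := P.strandDeriv_ne_zero a t
  have hVn : 0 < ‖V‖ := norm_pos_iff.2 hV0
  have hw0 : w ≠ 0 := by rintro rfl; simp at hw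
  have hwn : 0 < ‖w‖ := norm_pos_iff.2 hw0
  set κ := min (‖V‖ / 2) (-(w * starRingEnd ℂ V).im / (2 * ‖w‖)) with hκ
  have hκ0 : 0 < κ := lt_min (half_pos hVn) (div_pos (by linarith) (by positivity))
  obtain ⟨δ, η, hF⟩ := P.exists_isSimpleFrame h hκ0
  have hsideV : κ * ‖-(I * V)‖ < (-1) * (-(I * V) * starRingEnd ℂ V).im := by
    have e : (-(I * V) * starRingEnd ℂ V).im = -‖V‖ ^ 2 := by
      rw [neg_mul, Complex.neg_im, im_I_mul_mul_conj]
    rw [e, norm_neg, norm_mul, Complex.norm_I, one_mul]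
    have := min_le_left (‖V‖ / 2) (-(w * starRingEnd ℂ V).im / (2 * ‖w‖))
    nlinarith
  have hsidew : κ * ‖w‖ < (-1) * (w * starRingEnd ℂ V).im := by
    have h1 := min_le_right (‖V‖ / 2) (-(w * starRingEnd ℂ V).im / (2 * ‖w‖))
    rw [← hκ] at h1
    have h2 : -(w * starRingEnd ℂ V).im / (2 * ‖w‖) * ‖w‖ = -(w * starRingEnd ℂ V).im / 2 := by
      field_simp
    nlinarith [mul_le_mul_of_nonneg_right h1 hwn.le]
  set ε₁ := η / (2 * (‖V‖ + ‖w‖)) with hε₁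
  have hε₁0 : 0 < ε₁ := div_pos hF.η_pos (by positivity)
  have hε₁η : ε₁ * (‖V‖ + ‖w‖) < η := by
    rw [hε₁, div_mul_eq_mul_div, div_lt_iff₀ (by positivity)]; nlinarith [hF.η_pos]
  have key : ∀ ε ∈ Ioo (0 : ℝ) ε₁, L.windSum (y + (ε : ℂ) * w) =
      L.windSum (y - (ε : ℂ) * (I * V)) := by
    intro ε hε
    have h0 : |(0 : ℝ)| ≤ δ := by rw [abs_zero]; exact hF.δ_pos.le
    have := hF.windSum_add_eq P hκ0.le h0 (Or.inr rfl) (side_smul hε.1 hsidew)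
      (side_smul hε.1 hsideV)
    simp only [add_zero, sub_self, norm_zero, zero_add, norm_mul, Complex.norm_real,
      Real.norm_eq_abs, Complex.norm_I, one_mul, abs_of_pos hε.1, norm_neg] at this
    have e : L.strand a t + (ε : ℂ) * -(I * V) = y - (ε : ℂ) * (I * V) := by rw [hy]; ring
    rw [e] at this
    exact this (by nlinarith [hε.2, hε.1]) (by nlinarith [hε.2, hε.1])
  filter_upwards [mem_of_superset (Ioo_mem_nhdsGT hε₁0) key, P.leftWind_spec h,
    P.windSum_left_sub_right h] with ε h1 h2 h3
  rw [h1]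
  linarith

/-! ### The left winding number is constant along arcs of simple points -/

/-- Nearby parameters of a simple point are simple points. [folklore] -/
theorem IsSimplePt.eventually (P : L.RegularProjection) [Fintype ι] {a : ι} {t : ℝ}
    (h : L.IsSimplePt a t) : ∀ᶠ τ in 𝓝 (0 : ℝ), L.IsSimplePt a (t + τ) := by
  set V := L.strandDeriv a t with hV
  have hV0 : V ≠ 0 := P.strandDeriv_ne_zero a t
  have hVn : 0 < ‖V‖ := norm_pos_iff.2 hV0
  obtain ⟨δ, η, hF⟩ := P.exists_isSimpleFrame h (half_pos hVn)
  set τ₁ := min δ (η / (2 * (‖V‖ / 2 + ‖V‖))) with hτ₁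
  have hτ₁0 : 0 < τ₁ := lt_min hF.δ_pos (div_pos hF.η_pos (by positivity))
  filter_upwards [Metric.ball_mem_nhds (0 : ℝ) hτ₁0] with τ hτ
  rw [Metric.mem_ball, dist_zero_right, Real.norm_eq_abs] at hτ
  have hτδ : |τ| ≤ δ := (hτ.trans_le (min_le_left _ _)).le
  have hτη : ‖L.strand a (t + τ) - L.strand a t‖ < η := by
    refine (hF.norm_strand_sub_le hτδ).trans_lt ?_
    have h1 : |τ| < η / (2 * (‖V‖ / 2 + ‖V‖)) := hτ.trans_le (min_le_right _ _)
    rw [lt_div_iff₀ (by positivity)] at h1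
    nlinarith [abs_nonneg τ]
  intro c u hu
  have hclose : ‖L.strand c u - L.strand a t‖ < η := by rwa [hu]
  obtain ⟨rfl, k, hk⟩ := hF.far c u hclose
  refine ⟨rfl, k, ?_⟩
  set s := u - t - k * (2 * π) with hs
  have hus : L.strand c u = L.strand c (t + s) := by
    rw [show u = t + s + k * (2 * π) by rw [hs]; ring, L.strand_add_int_mul]
  rw [hus] at hu
  have hc := hF.cone s τ hk.le hτδ
  rw [hu, sub_self, zero_sub, norm_neg, norm_mul, Complex.norm_real, Real.norm_eq_abs] at hc
  have : |s - τ| = 0 := by nlinarith [abs_nonneg (s - τ)]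
  rw [abs_eq_zero, sub_eq_zero] at this
  rw [← this, hs]; ring

/-- **Local constancy**: near a simple point the left winding number is constant (compare the
left points of nearby parameters through the uniform cone and a short path beside the strand).
[folklore] -/
theorem leftWind_eventually_eq (P : L.RegularProjection) [Fintype ι] {a : ι} {t : ℝ}
    (h : L.IsSimplePt a t) : ∀ᶠ t' in 𝓝 t, L.leftWind a t' = L.leftWind a t := by
  set V := L.strandDeriv a t with hV
  set y := L.strand a t with hy
  have hV0 : V ≠ 0 := P.strandDeriv_ne_zero a t
  have hVn : 0 < ‖V‖ := norm_pos_iff.2 hV0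
  set κ := ‖V‖ / 4 with hκ
  have hκ0 : 0 < κ := by positivity
  obtain ⟨δ, η, hF⟩ := P.exists_isSimpleFrame h hκ0
  set M := κ + ‖V‖ + 1 with hM
  have hM0 : 0 < M := by positivity
  set τ₁ := min δ (η / (4 * M)) with hτ₁
  have hτ₁0 : 0 < τ₁ := lt_min hF.δ_pos (div_pos hF.η_pos (by positivity))
  have hsimple := IsSimplePt.eventually P h
  have hball : ∀ᶠ τ in 𝓝 (0 : ℝ), |τ| < τ₁ := by
    filter_upwards [Metric.ball_mem_nhds (0 : ℝ) hτ₁0] with τ hτ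
    rwa [Metric.mem_ball, dist_zero_right, Real.norm_eq_abs] at hτ
  have hmain : ∀ᶠ τ in 𝓝 (0 : ℝ), L.leftWind a (t + τ) = L.leftWind a t := by
    filter_upwards [hsimple, hball] with τ hsτ hτ
    have hτδ : |τ| ≤ δ := (hτ.trans_le (min_le_left _ _)).le
    have hτη : (κ + ‖V‖) * |τ| < η / 4 := by
      have h1 : |τ| < η / (4 * M) := hτ.trans_le (min_le_right _ _)
      rw [lt_div_iff₀ (by positivity)] at h1
      have : (κ + ‖V‖) * |τ| ≤ M * |τ| := by rw [hM]; nlinarith [abs_nonneg τ]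
      linarith
    have hdist : ‖L.strand a (t + τ) - y‖ < η / 4 := (hF.norm_strand_sub_le hτδ).trans_lt hτη
    set ε₁ := η / (4 * M) with hε₁
    have hε₁0 : 0 < ε₁ := div_pos hF.η_pos (by positivity)
    have hI : ∀ᶠ ε in 𝓝[>] (0 : ℝ), ε ∈ Ioo 0 ε₁ := Ioo_mem_nhdsGT hε₁0
    obtain ⟨ε, ⟨hε0, hεε₁⟩, hspec₁, hspec₀⟩ :=
      (hI.and ((P.leftWind_spec hsτ).and (P.leftWind_spec h))).exists
    have hεM : ε * M < η / 4 := by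
      rw [hε₁, lt_div_iff₀ (by positivity)] at hεε₁; linarith
    set Vτ := L.strandDeriv a (t + τ) with hVτ
    have hvel : ‖Vτ - V‖ ≤ κ := hF.vel τ hτδ
    -- (1) replace `i Vτ` by `i V` at the point `γ (t + τ)`
    have hside1 : κ * ‖I * Vτ‖ < 1 * (I * Vτ * starRingEnd ℂ V).im := by
      have e : I * Vτ * starRingEnd ℂ V =
          I * V * starRingEnd ℂ V + I * ((Vτ - V) * starRingEnd ℂ V) := by
        ring
      rw [e, Complex.add_im, im_I_mul_mul_conj, norm_mul, Complex.norm_I, one_mul, one_mul]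
      have hb : |(I * ((Vτ - V) * starRingEnd ℂ V)).im| ≤ κ * ‖V‖ := by
        refine (Complex.abs_im_le_norm _).trans ?_
        rw [norm_mul, Complex.norm_I, one_mul, norm_mul, Complex.norm_conj]
        exact mul_le_mul_of_nonneg_right hvel hVn.le
      have hVτ : ‖Vτ‖ ≤ ‖V‖ + κ := by
        have := norm_add_le V (Vτ - V); rw [add_sub_cancel] at this; linarith
      have := neg_abs_le (I * ((Vτ - V) * starRingEnd ℂ V)).im
      rw [hκ] at hb hVτ ⊢
      nlinarith
    have hside2 : κ * ‖I * V‖ < 1 * (I * V * starRingEnd ℂ V).im := by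
      rw [im_I_mul_mul_conj, norm_mul, Complex.norm_I, one_mul, one_mul, hκ]; nlinarith
    have hVτn : ‖Vτ‖ ≤ M := by
      have := norm_add_le V (Vτ - V); rw [add_sub_cancel] at this; rw [hM]; linarith
    have step1 : L.windSum (L.strand a (t + τ) + (ε : ℂ) * (I * Vτ)) =
        L.windSum (L.strand a (t + τ) + (ε : ℂ) * (I * V)) := by
      refine hF.windSum_add_eq P hκ0.le hτδ (Or.inl rfl) (side_smul hε0 hside1)
        (side_smul hε0 hside2) ?_ ?_
      · rw [norm_mul, Complex.norm_real, Real.norm_eq_abs, abs_of_pos hε0, norm_mul,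
          Complex.norm_I, one_mul]
        nlinarith
      · rw [norm_mul, Complex.norm_real, Real.norm_eq_abs, abs_of_pos hε0, norm_mul,
          Complex.norm_I, one_mul]
        have : ‖V‖ ≤ M := by rw [hM]; linarith
        nlinarith
    -- (2) slide the base point back to `t` beside the strand
    have step2 : L.windSum (L.strand a (t + τ) + (ε : ℂ) * (I * V)) =
        L.windSum (y + (ε : ℂ) * (I * V)) := by
      have := P.windSum_eq_of_path (c := fun μ : ℝ => L.strand a (t + μ * τ) + (ε : ℂ) * (I * V))
        zero_le_one (((P.continuous_strand a).comp (by fun_prop)).add continuous_const).continuousOn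
        fun μ hμ => ?_
      · simpa [hy] using this.symm
      · have hμτ : |μ * τ| ≤ |τ| := by
          rw [abs_mul]
          have : |μ| ≤ 1 := by rw [abs_le]; constructor <;> linarith [hμ.1, hμ.2]
          nlinarith [abs_nonneg τ]
        refine hF.add_notMem hκ0.le (hμτ.trans hτδ)
          (side_abs (Or.inl rfl) (side_smul hε0 hside2)) ?_
        rw [norm_mul, Complex.norm_real, Real.norm_eq_abs, abs_of_pos hε0, norm_mul,
          Complex.norm_I, one_mul]
        have := hF.norm_strand_sub_le (hμτ.trans hτδ)
        have hVM : ‖V‖ ≤ M := by rw [hM]; linarith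
        nlinarith [abs_nonneg τ]
    rw [← hspec₁, step1, step2, hspec₀]
  -- translate `τ → t + τ`
  rw [show (𝓝 t) = Filter.map (fun τ => t + τ) (𝓝 0) from (map_add_left_nhds_zero t).symm]
  exact Filter.eventually_map.2 hmain

/-- **Constancy along arcs of simple points**: on an interval of simple points the left winding
number is constant. [folklore] -/
theorem leftWind_eq_of_isSimplePt (P : L.RegularProjection) [Fintype ι] {a : ι} {t₁ t₂ : ℝ}
    (h12 : t₁ ≤ t₂) (h : ∀ t ∈ Icc t₁ t₂, L.IsSimplePt a t) :
    L.leftWind a t₁ = L.leftWind a t₂ := by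
  refine isPreconnected_Icc.constant (f := L.leftWind a) (fun t₀ ht₀ => ?_)
    (left_mem_Icc.2 h12) (right_mem_Icc.2 h12)
  have hev := P.leftWind_eventually_eq (h t₀ ht₀)
  have hca : ContinuousAt (L.leftWind a) t₀ :=
    tendsto_const_nhds.congr' (hev.mono fun t ht => ht.symm)
  exact hca.continuousWithinAt

end RegularProjection

end Link

end Literature.Topology.FourManifolds
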